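import Literature.NumberTheory.EllipticCurves.TateCurve.TransvectionOfTateParameterNotPower
import Literature.NumberTheory.EllipticCurves.TateCurve.NumberFieldUniformizationTwistedValuation
import Literature.NumberTheory.EllipticCurves.MultiplicativeReductionJValuationProofs
import HarnessLib

/-!
# Route `GenusKolyvaginAtTwo`, residual `OffCutResidualAtTwoR` (stmt-BirchSwinnertonDyer-31767), LINE 26 «lw2_phantom_exclusion» /
# LINE 33–34 F4′: THE TATE WITNESS AT A MULTIPLICATIVE PLACE OF ANY RESIDUE CHARACTERISTIC — part 1, the KUMMER STEP at level `4`
# and the valuations `v(q) = v(Δ_min)` odd, `v(γ)` even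

Width seat `bsd-line-gk2-p5` g41 (cell `bsd-f1-sign2`), `--supports stmt-BirchSwinnertonDyer-31767 --as helper`.  THEOREMS ONLY (no
definition, no named fact, no `sorry`).  **BSD is NOT proved by this file; nothing is closed by it.**

WHY.  The `(NPh)`-fed engine of the route (LINES 18/24/26, the K₄± lines 33/34 through F4′ `stub_offCutNonPhantom`) needs ONE place at
which the Lawson–Wuthrich level-4 phantom class is NOT Kummer.  The tree kills it at an ODD multiplicative place
(`NonPhantom.eq_zero_of_h1Eval_eq_zero_of_mem_selmerLocalKer`, hypothesis `v ∤ 2`: the INERTIAL Tate transvection + «Kummer ⟹ unramified ⟹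
principal on inertia»).  At `v ∣ 2` the inertia group of `ℚ₂(i)` only supplies `u²` (the «V2-phantom» memo), yet LINE 26's instrument finds a
witness at `v = 2` on 17/17 habitat cells multiplicative at `2`.  The resolution (this seat): do NOT use inertia — Tate's (twisted) uniformisation
`Ψ : K̄_v^× → E(K̄_v)` (tree, DISCHARGED: `uniformization_holds`, `isomorphic_tateCurve_of_one_lt_norm_j_holds`, `smul_eq_sign_smul`) gives an
element `τ ∈ Γ_{K_v}` fixing `i = √−1` and `t = √γ` with `τ q^{1/4} = i^j q^{1/4}`, `j` odd, as soon as `q ∉ {±1, ±γ}·K_v^{×2}`; such a `τ` is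
unipotent on `E[4]`, moves `E[2]`, and EVERY local Kummer cocycle is principal on it (part 2, `…Lw2TateWitnessLocal`).  This file supplies:

* §1 `TateFour.exists_eq_or_eq_mul_of_fixed_of_fixing` — quadratic Kummer descent along `F(i)/F` in character form (an element `y` with
  `ρ y = ± y` for all `ρ ∈ Gal(F̄/F)`, fixed by the stabiliser of `i`, lies in `F ∪ iF`); `TateFour.exists_gal_fix_smul_fourthRoot_eq` — THE
  KUMMER STEP AT LEVEL 4: `q ∉ {±1,±γ}F^{×2}`, `i² = −1`, `Q⁴ = q`, `t² = γ ≠ 0` ⟹ some `σ ∈ Gal(F̄/F)` fixes `i`, `t` and has `σ Q = i^j Q`,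
  `j` odd (the `p = 2` analogue of the tree's `TateCurve.exists_gal_smul_root_eq_of_forall_pow_ne`, whose squaring trick fails at `p = 2`;
  replaced by a two-character argument); `TateFour.isPrimitiveRoot_four_of_sq_eq_neg_one`.
* §2 `TateFour.exists_valued_gamma_eq_exp_two_mul` — at a multiplicative place `v(γ(W)) = v(−c₄/c₆)` is an EVEN power (local minimal model:
  `v(c₄) = v(c₆) = 1` from `c₆² = c₄³ − 1728Δ`, `v(Δ) < 1`; `γ` changes by `u²`); `TateFour.tateParameter_not_mem_sq_classes` — with
  `ord_v Δ_min` odd the Tate parameter (`|q|_v = |j|_v⁻¹`, `ord_v j = −ord_v Δ_min`) is not in `{±1, ±γ}·K_v^{×2}`.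

References: [SilvermanATAEC1994] Lemma V.5.1, Lemma V.5.2, Thm. V.5.3, proof of Prop. V.6.1 (PDF pp. 406–411); [SilvermanAEC2009] Prop. VII.5.1 (b),
III.1; [LawsonWuthrich2016] §7.1, §8 (the odd-place mechanism this replaces at `v ∣ 2`).
-/

set_option linter.dupNamespace false -- tree convention: `Summit.BirchSwinnertonDyer.BirchSwinnertonDyer.Theorems` (summit = sub-problem)
set_option autoImplicit false

noncomputable section

open scoped Classical
open Field NumberField IsDedekindDomain WeierstrassCurve

namespace Summit.BirchSwinnertonDyer.BirchSwinnertonDyer.Theorems.GenusExact.NonPhantom.TateFour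

open Literature.NumberTheory.EllipticCurves Literature.NumberTheory.EllipticCurves.TateCurve
  Literature.NumberTheory.GaloisRepresentations SteinWuthrich2013

/-! ## §1 The Kummer step at level `4` (pure field theory, characteristic `0`) -/

section Kummer

variable {F : Type*} [Field F] [CharZero F]

/-- `i² = −1` gives a primitive fourth root of unity (characteristic `0`). [folklore] -/
theorem isPrimitiveRoot_four_of_sq_eq_neg_one {L : Type*} [Field L] [CharZero L] {i : L} (hi : i ^ 2 = -1) :
    IsPrimitiveRoot i 4 := by
  have hi4' : i ^ 4 = 1 := by
    calc i ^ 4 = (i ^ 2) ^ 2 := by ring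
      _ = 1 := by rw [hi]; norm_num
  refine IsPrimitiveRoot.mk_of_lt i (by norm_num) hi4' ?_
  intro l hl0 hl4
  have hi1 : i ≠ 1 := by
    rintro rfl
    norm_num at hi
  interval_cases l
  · rwa [pow_one]
  · rw [hi]; norm_num
  · intro h
    have h' : i ^ 4 = i := by rw [pow_succ, h, one_mul]
    rw [hi4'] at h'
    exact hi1 h'.symm


/-- **Quadratic Kummer descent along `F(i)/F` (character form).**  `i² = −1`; `y ∈ F̄` with `ρ y = ± y` for every
`ρ ∈ Gal(F̄/F)` (e.g. `y² ∈ F`), fixed by every `ρ` fixing `i`: then `y = x` or `y = i·x` for some `x ∈ F`.  Proof: if some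
`ρ₀` has `ρ₀ y = −y` then `ρ₀ i = −i`, and every `ρ` with `ρ i = −i` differs from `ρ₀` by an element fixing `i`, so
`ρ (y/i) = y/i` for all `ρ`; an element fixed by `Gal(F̄/F)` lies in `F`. [folklore] -/
theorem exists_eq_or_eq_mul_of_fixed_of_fixing {i y : AlgebraicClosure F} (hi : i ^ 2 = -1)
    (hy : ∀ ρ : AlgebraicClosure F ≃ₐ[F] AlgebraicClosure F, ρ y = y ∨ ρ y = -y)
    (hfix : ∀ ρ : AlgebraicClosure F ≃ₐ[F] AlgebraicClosure F, ρ i = i → ρ y = y) :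
    ∃ x : F, y = algebraMap F (AlgebraicClosure F) x ∨ y = i * algebraMap F (AlgebraicClosure F) x := by
  haveI : IsGalois F (AlgebraicClosure F) := {}
  have hi0 : i ≠ 0 := by
    rintro rfl
    norm_num at hi
  have hρi : ∀ ρ : AlgebraicClosure F ≃ₐ[F] AlgebraicClosure F, ρ i = i ∨ ρ i = -i := fun ρ ↦ by
    apply sq_eq_sq_iff_eq_or_eq_neg.mp
    rw [← map_pow, hi, map_neg, map_one]
  by_cases hall : ∀ ρ : AlgebraicClosure F ≃ₐ[F] AlgebraicClosure F, ρ y = y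
  · obtain ⟨x, hx⟩ := (InfiniteGalois.mem_range_algebraMap_iff_fixed y).mpr hall
    exact ⟨x, Or.inl hx.symm⟩
  · push Not at hall
    obtain ⟨ρ₀, hρ₀⟩ := hall
    have hρ₀y : ρ₀ y = -y := (hy ρ₀).resolve_left hρ₀
    have hρ₀i : ρ₀ i = -i := by
      rcases hρi ρ₀ with h | h
      · exact absurd (hfix ρ₀ h) hρ₀
      · exact h
    have h2 : ρ₀.symm i = -i := by
      apply ρ₀.injective
      rw [AlgEquiv.apply_symm_apply, map_neg, hρ₀i, neg_neg]
    have h5 : ρ₀.symm y = -y := by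
      apply ρ₀.injective
      rw [AlgEquiv.apply_symm_apply, map_neg, hρ₀y, neg_neg]
    -- `y / i` is fixed by everybody
    have hfix' : ∀ ρ : AlgebraicClosure F ≃ₐ[F] AlgebraicClosure F, ρ (y * i⁻¹) = y * i⁻¹ := by
      intro ρ
      rcases hρi ρ with h | h
      · rw [map_mul, map_inv₀, h, hfix ρ h]
      · -- `ρ₀⁻¹ ∘ ρ`-type element `ψ x = ρ (ρ₀⁻¹ x)` fixes `i`, hence `y`
        have h3 : (ρ₀.symm.trans ρ) i = i := by
          rw [AlgEquiv.trans_apply, h2, map_neg, h, neg_neg]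
        have h4 := hfix _ h3
        rw [AlgEquiv.trans_apply, h5, map_neg] at h4
        rw [map_mul, map_inv₀, h, neg_eq_iff_eq_neg.mp h4, inv_neg, neg_mul_neg]
    obtain ⟨x, hx⟩ := (InfiniteGalois.mem_range_algebraMap_iff_fixed (y * i⁻¹)).mpr hfix'
    refine ⟨x, Or.inr ?_⟩
    rw [hx, mul_comm, inv_mul_cancel_right₀ hi0]

/-- **Kummer step of Silverman's proof of ATAEC Prop. V.6.1 at `p = 2`, LEVEL 4.**  Let `F` be a field of characteristic
`0`, `q, γ ∈ F` with `q ∉ {1, −1, γ, −γ}·F^{×2}`, `i ∈ F̄` with `i² = −1`, `Q ∈ F̄` with `Q⁴ = q`, `t ∈ F̄` with `t² = γ`,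
`t ≠ 0`.  Then some `σ ∈ Gal(F̄/F)` fixes `i` and `t` and has `σ Q = i^j · Q` with `j` ODD (so `σ` generates
`Gal(F(i,t,Q)/F(i,t)) ≅ ℤ/4`).  Proof: every `σ` has `σ Q = i^j Q`; if no `σ` fixing `i` had `j` odd, `s = Q²` would be
fixed by `Gal(F̄/F(i))`, hence `s ∈ F ∪ iF` and `q = ± x²`; so some `σ₁` fixing `i` has `j` odd; if `σ₁ t = −t` and no
`σ₂` fixing `i` with `σ₂ Q = ± Q` moves `t`, then `σ(s/t) = s/t` on `Gal(F̄/F(i))`, hence `s/t ∈ F ∪ iF` and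
`q = ± γ x²`. [cite: SilvermanATAEC1994, proof of Prop. V.6.1 (PDF p. 411)] -/
theorem exists_gal_fix_smul_fourthRoot_eq {q γ : F}
    (hq₁ : ∀ x : F, x ^ 2 ≠ q) (hq₂ : ∀ x : F, x ^ 2 ≠ -q)
    (hq₃ : ∀ x : F, γ * x ^ 2 ≠ q) (hq₄ : ∀ x : F, γ * x ^ 2 ≠ -q)
    {i Q t : AlgebraicClosure F} (hi : i ^ 2 = -1)
    (hQ : Q ^ 4 = algebraMap F (AlgebraicClosure F) q)
    (ht : t ^ 2 = algebraMap F (AlgebraicClosure F) γ) (ht0 : t ≠ 0) :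
    ∃ (σ : absoluteGaloisGroup F) (j : ℕ),
      σ • i = i ∧ σ • t = t ∧ σ • Q = i ^ j * Q ∧ ¬ 2 ∣ j := by
  haveI : IsGalois F (AlgebraicClosure F) := {}
  have hq0 : q ≠ 0 := fun h ↦ hq₁ 0 (by rw [h]; ring)
  have hq0' : algebraMap F (AlgebraicClosure F) q ≠ 0 := (_root_.map_ne_zero _).mpr hq0
  have hQ0 : Q ≠ 0 := by
    rintro rfl
    rw [zero_pow four_ne_zero] at hQ
    exact hq0' hQ.symm
  have hi4 : IsPrimitiveRoot i 4 := isPrimitiveRoot_four_of_sq_eq_neg_one hi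
  -- every `ρ` acts on `Q` through a power of `i`
  have hrot : ∀ ρ : AlgebraicClosure F ≃ₐ[F] AlgebraicClosure F, ∃ j : ℕ, j < 4 ∧ ρ Q = i ^ j * Q := by
    intro ρ
    have hw : (ρ Q * Q⁻¹) ^ 4 = 1 := by
      rw [mul_pow, inv_pow, ← map_pow, hQ, AlgEquiv.commutes, mul_inv_cancel₀ hq0']
    obtain ⟨j, hj, hje⟩ := hi4.eq_pow_of_pow_eq_one hw
    exact ⟨j, hj, by rw [hje, inv_mul_cancel_right₀ hQ0]⟩
  -- `ρ t = ± t`, `ρ s = ± s` for `s = Q²`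
  have hρt : ∀ ρ : AlgebraicClosure F ≃ₐ[F] AlgebraicClosure F, ρ t = t ∨ ρ t = -t := fun ρ ↦ by
    apply sq_eq_sq_iff_eq_or_eq_neg.mp
    rw [← map_pow, ht, AlgEquiv.commutes]
  have hs : (Q ^ 2) ^ 2 = algebraMap F (AlgebraicClosure F) q := by rw [← hQ]; ring
  have hρs : ∀ ρ : AlgebraicClosure F ≃ₐ[F] AlgebraicClosure F, ρ (Q ^ 2) = Q ^ 2 ∨ ρ (Q ^ 2) = -(Q ^ 2) :=
    fun ρ ↦ by
      apply sq_eq_sq_iff_eq_or_eq_neg.mp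
      rw [← map_pow, hs, AlgEquiv.commutes]
  -- the action of `ρ` on `s = Q²` in terms of `j`: `ρ s = (i^j)² s = (-1)^j s`
  have hρs' : ∀ (ρ : AlgebraicClosure F ≃ₐ[F] AlgebraicClosure F) (j : ℕ), ρ Q = i ^ j * Q →
      ρ (Q ^ 2) = (-1) ^ j * Q ^ 2 := by
    intro ρ j h
    rw [map_pow, h, mul_pow, ← pow_mul, mul_comm j 2, pow_mul, hi]
  -- Step 1: some `σ₁` fixing `i` has `j` odd
  obtain ⟨σ₁, j₁, hσ₁i, hσ₁Q, hj₁⟩ : ∃ (σ : AlgebraicClosure F ≃ₐ[F] AlgebraicClosure F) (j : ℕ),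
      σ i = i ∧ σ Q = i ^ j * Q ∧ ¬ 2 ∣ j := by
    by_contra hne
    push Not at hne
    -- then `s = Q²` is fixed by every `ρ` fixing `i`
    have hfix : ∀ ρ : AlgebraicClosure F ≃ₐ[F] AlgebraicClosure F, ρ i = i → ρ (Q ^ 2) = Q ^ 2 := by
      intro ρ hρi
      obtain ⟨j, -, hj⟩ := hrot ρ
      have h2j : 2 ∣ j := hne ρ j hρi hj
      rw [hρs' ρ j hj, Even.neg_one_pow (even_iff_two_dvd.mpr h2j), one_mul]
    obtain ⟨x, hx⟩ := exists_eq_or_eq_mul_of_fixed_of_fixing hi hρs hfix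
    rcases hx with hx | hx
    · apply hq₁ x
      apply (algebraMap F (AlgebraicClosure F)).injective
      rw [map_pow, ← hx, hs]
    · apply hq₂ x
      apply (algebraMap F (AlgebraicClosure F)).injective
      rw [map_neg, map_pow, ← hs, hx, mul_pow, hi]
      ring
  -- Step 2/3
  obtain ⟨σ, j, hσi, hσt, hσQ, hj⟩ : ∃ (σ : AlgebraicClosure F ≃ₐ[F] AlgebraicClosure F) (j : ℕ),
      σ i = i ∧ σ t = t ∧ σ Q = i ^ j * Q ∧ ¬ 2 ∣ j := by
    rcases hρt σ₁ with h1 | h1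
    · exact ⟨σ₁, j₁, hσ₁i, h1, hσ₁Q, hj₁⟩
    · -- `σ₁ t = -t`; look for `σ₂` fixing `i`, `σ₂ Q = ± Q`, `σ₂ t = -t`
      by_cases h2 : ∃ (σ₂ : AlgebraicClosure F ≃ₐ[F] AlgebraicClosure F) (j₂ : ℕ),
          σ₂ i = i ∧ σ₂ Q = i ^ j₂ * Q ∧ 2 ∣ j₂ ∧ σ₂ t = -t
      · obtain ⟨σ₂, j₂, hσ₂i, hσ₂Q, hj₂, hσ₂t⟩ := h2
        refine ⟨σ₁.trans σ₂, j₁ + j₂, ?_, ?_, ?_, ?_⟩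
        · rw [AlgEquiv.trans_apply, hσ₁i, hσ₂i]
        · rw [AlgEquiv.trans_apply, h1, map_neg, hσ₂t, neg_neg]
        · rw [AlgEquiv.trans_apply, hσ₁Q, map_mul, map_pow, hσ₂i, hσ₂Q, pow_add]
          ring
        · omega
      · push Not at h2
        -- then `y = Q² / t` is fixed by every `ρ` fixing `i`
        have hfix : ∀ ρ : AlgebraicClosure F ≃ₐ[F] AlgebraicClosure F, ρ i = i →
            ρ (Q ^ 2 * t⁻¹) = Q ^ 2 * t⁻¹ := by
          intro ρ hρi
          obtain ⟨j, -, hjQ⟩ := hrot ρ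
          rcases hρt ρ with h3 | h3
          · -- `ρ t = t`: then `j` must be even (else `σ₁ ∘ ρ` contradicts `h2`)
            have h2j : 2 ∣ j := by
              by_contra hodd
              have hA : (ρ.trans σ₁) i = i := by rw [AlgEquiv.trans_apply, hρi, hσ₁i]
              have hB : (ρ.trans σ₁) Q = i ^ (j + j₁) * Q := by
                rw [AlgEquiv.trans_apply, hjQ, map_mul, map_pow, hσ₁i, hσ₁Q, pow_add]
                ring
              have hC : (ρ.trans σ₁) t = -t := by rw [AlgEquiv.trans_apply, h3, h1]
              exact h2 _ _ hA hB (by omega) hC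
            rw [map_mul, map_inv₀, h3, hρs' ρ j hjQ, Even.neg_one_pow (even_iff_two_dvd.mpr h2j), one_mul]
          · -- `ρ t = -t`: then `j` is odd (by `h2`), so `ρ s = -s`
            have hj' : ¬ 2 ∣ j := fun h2j ↦ h2 ρ j hρi hjQ h2j h3
            rw [map_mul, map_inv₀, h3, hρs' ρ j hjQ, Odd.neg_one_pow (Nat.odd_iff.mpr (by omega)),
              inv_neg]
            ring
        have hy : ∀ ρ : AlgebraicClosure F ≃ₐ[F] AlgebraicClosure F,
            ρ (Q ^ 2 * t⁻¹) = Q ^ 2 * t⁻¹ ∨ ρ (Q ^ 2 * t⁻¹) = -(Q ^ 2 * t⁻¹) := by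
          intro ρ
          rw [map_mul, map_inv₀]
          rcases hρs ρ with h4 | h4 <;> rcases hρt ρ with h5 | h5 <;> rw [h4, h5]
          · exact Or.inl rfl
          · right; rw [inv_neg]; ring
          · right; ring
          · left; rw [inv_neg]; ring
        obtain ⟨x, hx⟩ := exists_eq_or_eq_mul_of_fixed_of_fixing hi hy hfix
        exfalso
        rcases hx with hx | hx
        · -- `Q² = x t` ⇒ `q = γ x²`
          have hx' : Q ^ 2 = algebraMap F (AlgebraicClosure F) x * t := by
            rw [← hx, inv_mul_cancel_right₀ ht0]
          apply hq₃ x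
          apply (algebraMap F (AlgebraicClosure F)).injective
          rw [map_mul, map_pow, ← hs, hx', mul_pow, ht]
          ring
        · -- `Q² = i t x` ⇒ `q = -γ x²`
          have hx' : Q ^ 2 = i * algebraMap F (AlgebraicClosure F) x * t := by
            rw [← hx, inv_mul_cancel_right₀ ht0]
          apply hq₄ x
          apply (algebraMap F (AlgebraicClosure F)).injective
          rw [map_neg, map_mul, map_pow, ← hs, hx']
          calc algebraMap F (AlgebraicClosure F) γ * (algebraMap F (AlgebraicClosure F) x) ^ 2
              = -(i ^ 2 * t ^ 2 * (algebraMap F (AlgebraicClosure F) x) ^ 2) := by rw [hi, ht]; ring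
            _ = -((i * algebraMap F (AlgebraicClosure F) x * t) ^ 2) := by ring
  refine ⟨(absoluteGaloisGroup.toAlgEquiv F).symm σ, j, ?_, ?_, ?_, hj⟩
  · rw [absoluteGaloisGroup.toAlgEquiv_symm_apply, hσi]
  · rw [absoluteGaloisGroup.toAlgEquiv_symm_apply, hσt]
  · rw [absoluteGaloisGroup.toAlgEquiv_symm_apply, hσQ]

end Kummer

/-! ## §2 Valuations at a multiplicative place: `v(γ)` even, `v(q)` odd -/

section Valuation

variable {K : Type} [Field K] [NumberField K] (W : WeierstrassCurve K) (v : HeightOneSpectrum (𝓞 K))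

/-- At a place `v` of multiplicative reduction the square class `γ(W) = -c₄/c₆` has EVEN valuation:
`v(γ) = exp(2m)` in `K_v` (for the local minimal model `E = C₀ • (W ⊗ K_v)` one has `v(c₄(E)) = v(c₆(E)) = 1` —
`c₆² = c₄³ − 1728Δ` with `v(Δ) < 1` — and `c₄(W) = u⁴ c₄(E)`, `c₆(W) = u⁶ c₆(E)`, `u = u_{C₀} ∈ K_v^×`).
[cite: SilvermanAEC2009, Prop. VII.5.1 (b), III.1 (c-relation)] -/
theorem exists_valued_gamma_eq_exp_two_mul [W.IsElliptic] (hmult : W.HasMultiplicativeReductionAt v) :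
    ∃ m : ℤ, Valued.v (algebraMap K (v.adicCompletion K) (-(W.c₄ / W.c₆))) = WithZero.exp (2 * m) := by
  obtain ⟨C₀, hm⟩ : ∃ C : VariableChange (v.adicCompletion K),
      (C • W.baseChange (v.adicCompletion K)).HasMultiplicativeReduction (v.adicCompletionIntegers K) :=
    ⟨_, hmult⟩
  set E := C₀ • W.baseChange (v.adicCompletion K) with hE
  have hequiv := WeierstrassCurve.isEquiv_valuation_maximalIdeal_of_le_one_iff
    (WeierstrassCurve.valued_le_one_iff_mem_range_adicCompletionIntegers v (K := K))
  have hc₄ : (Valued.v : Valuation (v.adicCompletion K) (WithZero (Multiplicative ℤ))) E.c₄ = 1 :=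
    (Valuation.isEquiv_iff_val_eq_one.mp hequiv).mp hm.multiplicativeReduction
  have hΔ : (Valued.v : Valuation (v.adicCompletion K) (WithZero (Multiplicative ℤ))) E.Δ < 1 :=
    (Valuation.isEquiv_iff_val_lt_one.mp hequiv).mp hm.badReduction
  have h1728 : (Valued.v : Valuation (v.adicCompletion K) (WithZero (Multiplicative ℤ)))
      (1728 : v.adicCompletion K) ≤ 1 := by
    rw [WeierstrassCurve.valued_le_one_iff_mem_range_adicCompletionIntegers v (K := K)]
    exact ⟨1728, map_ofNat _ 1728⟩
  have hc₆sq : E.c₆ ^ 2 = E.c₄ ^ 3 - 1728 * E.Δ := by rw [E.c_relation]; ring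
  have hc₆ : (Valued.v : Valuation (v.adicCompletion K) (WithZero (Multiplicative ℤ))) E.c₆ = 1 := by
    have hlt : Valued.v (1728 * E.Δ) < Valued.v (E.c₄ ^ 3) := by
      rw [map_mul, map_pow, hc₄, one_pow]
      calc Valued.v (1728 : v.adicCompletion K) * Valued.v E.Δ ≤ 1 * Valued.v E.Δ := by gcongr
        _ < 1 := by rw [one_mul]; exact hΔ
    have h2 : Valued.v E.c₆ ^ 2 = 1 := by
      rw [← map_pow, hc₆sq, Valuation.map_sub_eq_of_lt_left _ hlt, map_pow, hc₄, one_pow]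
    rcases lt_trichotomy (Valued.v E.c₆) 1 with h | h | h
    · exact absurd h2 (pow_lt_one₀ zero_le h two_ne_zero).ne
    · exact h
    · exact absurd h2 (one_lt_pow₀ h two_ne_zero).ne'
  -- `c₄(W ⊗ K_v) = u⁴ c₄(E)`, `c₆(W ⊗ K_v) = u⁶ c₆(E)`
  have hu0 : Valued.v ((C₀.u⁻¹ : (v.adicCompletion K)ˣ) : v.adicCompletion K) ≠ 0 :=
    (Valuation.ne_zero_iff _).mpr (Units.ne_zero _)
  set x := Valued.v ((C₀.u⁻¹ : (v.adicCompletion K)ˣ) : v.adicCompletion K) with hx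
  have hE4 : x ^ 4 * Valued.v (W.baseChange (v.adicCompletion K)).c₄ = 1 := by
    rw [hx, ← map_pow, ← map_mul, ← variableChange_c₄, hc₄]
  have hE6 : x ^ 6 * Valued.v (W.baseChange (v.adicCompletion K)).c₆ = 1 := by
    rw [hx, ← map_pow, ← map_mul, ← variableChange_c₆, hc₆]
  refine ⟨WithZero.log x, ?_⟩
  have hxe : WithZero.exp (WithZero.log x) = x := WithZero.exp_log hu0
  rw [map_neg, map_div₀, ← W.map_c₄, ← W.map_c₆, Valuation.map_neg, map_div₀]
  change Valued.v (W.baseChange (v.adicCompletion K)).c₄ / Valued.v (W.baseChange (v.adicCompletion K)).c₆ = _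
  rw [eq_inv_of_mul_eq_one_right hE4, eq_inv_of_mul_eq_one_right hE6, two_mul, WithZero.exp_add, hxe]
  field_simp

/-- **The Tate parameter at a multiplicative place with `ord_v Δ_min` odd is not in `{±1, ±γ}·K_v²`.**  For `q ∈ K_v`
with `0 < |q|_v < 1` and `j(E_q) = j(W)`: `|q|_v = |j(W)|_v⁻¹` (ATAEC V.5.1), `ord_v j = −ord_v Δ_min` (AEC VII.5.1 (b)), so
`v(q) = exp(−ord_v Δ_min)` is an ODD power while `v(±x²)`, `v(±γx²)` are even powers.
[cite: SilvermanATAEC1994, Lemma V.5.1, Thm. V.5.3 (a)] [cite: SilvermanAEC2009, Prop. VII.5.1 (b)] -/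
theorem tateParameter_not_mem_sq_classes [W.IsElliptic] (hmult : W.HasMultiplicativeReductionAt v)
    (hodd : Odd (W.ordMinimalDiscriminant v)) {q : v.adicCompletion K} (hq0 : q ≠ 0) (hq : ‖q‖ < 1)
    (hqj : tateJ q = (W.baseChange (v.adicCompletion K)).j) :
    (∀ x : v.adicCompletion K, x ^ 2 ≠ q) ∧ (∀ x : v.adicCompletion K, x ^ 2 ≠ -q) ∧
      (∀ x : v.adicCompletion K, algebraMap K (v.adicCompletion K) (-(W.c₄ / W.c₆)) * x ^ 2 ≠ q) ∧
      (∀ x : v.adicCompletion K, algebraMap K (v.adicCompletion K) (-(W.c₄ / W.c₆)) * x ^ 2 ≠ -q) := by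
  letI := Literature.NumberTheory.GaloisRepresentations.Ultrametric.AdicCompletion.nontriviallyNormedField K v
  haveI := charZero_adicCompletion' K v
  -- `v(q) = exp(-n)`, `n = ord_v Δ_min` odd
  have hqn : ‖q‖ = ‖(W.baseChange (v.adicCompletion K)).j‖⁻¹ := by
    rw [← hqj, norm_tateJ_eq hq, inv_inv]
  have hqv : Valued.v q = WithZero.exp (-(W.ordMinimalDiscriminant v : ℤ)) := by
    have hjv : (W.baseChange (v.adicCompletion K)).j = algebraMap K (v.adicCompletion K) W.j := W.map_j _
    rw [valuation_eq_inv_of_norm_eq_inv K v hqn, hjv, WeierstrassCurve.valued_algebraMap_adicCompletion,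
      W.valuation_j_eq_exp_ordMinimalDiscriminant_of_hasMultiplicativeReductionAt v hmult, WithZero.exp_neg]
  obtain ⟨m, hγ⟩ := exists_valued_gamma_eq_exp_two_mul W v hmult
  obtain ⟨n₀, hn₀⟩ := hodd
  -- the valuation of a nonzero square is an even power
  have hsq : ∀ x : v.adicCompletion K, x ≠ 0 → ∃ k : ℤ, Valued.v (x ^ 2) = WithZero.exp (2 * k) := by
    intro x hx0
    refine ⟨WithZero.log (Valued.v x), ?_⟩
    rw [map_pow, two_mul, WithZero.exp_add, WithZero.exp_log ((Valuation.ne_zero_iff _).mpr hx0), sq]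
  have hx0 : ∀ x : v.adicCompletion K, (x ^ 2 = q ∨ x ^ 2 = -q ∨
      algebraMap K (v.adicCompletion K) (-(W.c₄ / W.c₆)) * x ^ 2 = q ∨
      algebraMap K (v.adicCompletion K) (-(W.c₄ / W.c₆)) * x ^ 2 = -q) → x ≠ 0 := by
    rintro x hx rfl
    simp only [zero_pow two_ne_zero, mul_zero, zero_eq_neg] at hx
    rcases hx with h | h | h | h <;> first | exact hq0 h.symm | exact hq0 h
  refine ⟨fun x h ↦ ?_, fun x h ↦ ?_, fun x h ↦ ?_, fun x h ↦ ?_⟩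
  · obtain ⟨k, hk⟩ := hsq x (hx0 x (Or.inl h))
    rw [h, hqv, WithZero.exp_inj] at hk
    omega
  · obtain ⟨k, hk⟩ := hsq x (hx0 x (Or.inr (Or.inl h)))
    rw [h, Valuation.map_neg, hqv, WithZero.exp_inj] at hk
    omega
  · obtain ⟨k, hk⟩ := hsq x (hx0 x (Or.inr (Or.inr (Or.inl h))))
    have h' := congrArg Valued.v h
    rw [map_mul, hγ, hk, ← WithZero.exp_add, hqv, WithZero.exp_inj] at h'
    omega
  · obtain ⟨k, hk⟩ := hsq x (hx0 x (Or.inr (Or.inr (Or.inr h))))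
    have h' := congrArg Valued.v h
    rw [map_mul, hγ, hk, ← WithZero.exp_add, Valuation.map_neg, hqv, WithZero.exp_inj] at h'
    omega

end Valuation

end Summit.BirchSwinnertonDyer.BirchSwinnertonDyer.Theorems.GenusExact.NonPhantom.TateFour

end
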